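import Mathlib.GroupTheory.FreeGroup.Basic
import Mathlib.Logic.Relation
import Literature.Topology.FourManifolds.PlanarAchiralWords
import HarnessLib

/-!
# The `F₂` shadow of the planar word calculus on the disc with three holes (definitions only)

Topic `Literature/Topology/FourManifolds`, companion of `PlanarAchiralWords.lean` (the signed planar
word calculus `Literature.Topology.FourManifolds.PlanarWords`).  General combinatorial group theory;
NOTHING is asserted (definitions plus `rfl`/`simp`-level sanity lemmas).  Written for the proof
line `Sketch` (k4-axis-calculus) of the crux `ConvexBisection.PlanarAcyclicBisectionRigidity`
(item stmt-SmoothPoincare4-15086, route route-SmoothPoincare4-ConvexBisection), whose registered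
stubs `stub_shadowWalkK4` (the lever) and `stub_k4Lift` (the lift back to `PlanarWords`) are
stated over exactly these declarations.

## Content

On the disc `D₃` with three holes the boundary-fixing mapping class group is `ℤ⁴ × F₂`
(framed pure braid group `PB₃ × ℤ³`, `PB₃ = ⟨Δ²⟩ × ⟨A₁₂, A₂₃⟩` with `⟨A₁₂, A₂₃⟩` free on the two
ROUND Dehn twists `x = T_[0,1]`, `y = T_[1,2]`; Farb–Margalit, *A Primer on Mapping Class Groups*
(2012) §9.3, bib key `FarbMargalit2012`).  Forgetting the central factor `ℤ⁴` (the four boundary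
twists) sends a positive Dehn twist about an essential curve of hole type `{0,1}` (resp. `{1,2}`)
to a conjugate of `x` (resp. `y`) in `F₂ = FreeGroup (Fin 2)`, a negative twist to a conjugate of
`x⁻¹` (resp. `y⁻¹`), and the signed Hurwitz move `(ℓ, ℓ′) ↦ (ℓ ℓ′ ℓ⁻¹, ℓ)` of
`PlanarWords.Move.hurwitz` to the same formula on group elements.  This file types that SHADOW:

* `F₂`, `gx`, `gy`; `IsPos g` (a conjugate of `x` or of `y` = the shadow of a positive letter);
  `XYPairs w` (ordered pairs (conjugate of `x`, conjugate of `y`) with product `w` = the shadows of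
  the minimal positive factorisations `(d, t_a, t_b)` of a monodromy with `F₂`-part `w`, central
  letter `d` dropped); `HurwitzEquiv w p q` (simultaneous conjugation by a power of `w` = Hurwitz
  equivalence of two-letter factorisations, since `σ² = Ad_w`).
* `Move`, `Reachable`: the signed Hurwitz move and its inverse at any LINEAR position of a list of
  group elements, and the equivalence relation they generate (no rotation and no global
  conjugation: on 4-tuples with product `1` a rotation is three Hurwitz moves followed by a global
  conjugation, and the targets below are conjugation invariant).
* `startState P Q = [P.1, P.2, Q.2⁻¹, Q.1⁻¹]`: the shadow of the block form `A · B̄ʳᵉᵛ` of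
  `PlanarWords.blockForm` for `A = (d, a₁, a₂)`, `B = (d, b₁, b₂)` (central letters dropped).
* Targets: `IsBallState` (two adjacent letters are the CHAIN `(c x c⁻¹, c y c⁻¹)` — the positive
  block `(d, c(c_[0,1]), c(c_[1,2]))` has seam `S³`, the half is a ball) and `IsDoubleState`
  (`[g₁, g₂, g₂⁻¹, g₁⁻¹]` with `g₁, g₂` positive — an honest double `X ∪ X̄`).
* `shadowGen`, `shadowWord`: the syntactic shadow `List PlanarWords.PGen → F₂` (`round 0 1 ∓`
  ↦ `x^{±1}`, `round 1 2 ∓ ↦ y^{±1}`, every other generator — in particular the boundary twists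
  `round i i`, `round 0 2` — to `1`), `shadowCurve`, `shadowLetter`; `IsXYGen`, `IsCentralCurve`,
  `InShadowNormalForm A B` (the `k = 4` reading of a planar ℚ-acyclic bisection: `A = [d, g₁(c_[0,1]),
  h₁(c_[1,2])]`, `B = [d, g₂(c_[0,1]), h₂(c_[1,2])]` with one common central letter `d`, carriers in
  the round sub-alphabet, and equal `F₂`-monodromies).
* Sanity lemmas: `Reachable.refl/symm/trans`, `Move.reachable`, `shadowWord_nil/append`,
  `startState_length`.

## What is NOT here (design)

No theorem relating the shadow to `PlanarWords.ArcData 3` (that `⟨T_[0,1], T_[1,2]⟩` is free, that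
boundary twists are central, that the shadow of a Hurwitz move is the Hurwitz move of the shadows)
and no walk theorem: those are the registered stubs `stub_k4Lift` / `stub_shadowWalkK4` of the line,
landed in their own files.  The conventions agree with `PlanarAchiralWords.lean`
(`PGen.round a b inv`, `inv = true` = negative twist; the Hurwitz move `(x, y) ↦ (x y x⁻¹, x)` and
its inverse `(x, y) ↦ (y, y⁻¹ x y)`).
-/

noncomputable section

namespace Literature.Topology.FourManifolds.PlanarShadow

open Literature.Topology.FourManifolds.PlanarWords

/-- The free group on two generators: the `F₂`-factor of `Mod(D₃, ∂) ≅ ℤ⁴ × F₂`, free on the round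
twists `x = T_[0,1]`, `y = T_[1,2]`. [cite: FarbMargalit2012, §9.3] -/
abbrev F₂ : Type := FreeGroup (Fin 2)

/-- The generator `x` (shadow of the round twist `T_[0,1]`). [folklore] -/
def gx : F₂ := FreeGroup.of 0

/-- The generator `y` (shadow of the round twist `T_[1,2]`). [folklore] -/
def gy : F₂ := FreeGroup.of 1

/-- A POSITIVE shadow letter: a conjugate of `x` or of `y` (the shadow of a positive Dehn twist
about an essential curve of hole type `{0,1}` or `{1,2}`). [folklore] -/
def IsPos (g : F₂) : Prop :=
  ∃ c : F₂, g = c * gx * c⁻¹ ∨ g = c * gy * c⁻¹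

/-- `XYPairs w`: ordered pairs (conjugate of `x`, conjugate of `y`) with product `w` — the shadows of
the two essential letters of a minimal positive factorisation `(d, t_a, t_b)` of a monodromy whose
`F₂`-part is `w`. [folklore] -/
def XYPairs (w : F₂) : Set (F₂ × F₂) :=
  {p | (∃ c : F₂, p.1 = c * gx * c⁻¹) ∧ (∃ c : F₂, p.2 = c * gy * c⁻¹) ∧ p.1 * p.2 = w}

/-- Hurwitz equivalence of two-letter factorisations of `w`: simultaneous conjugation by a power of
`w` (the square of the Hurwitz braid `σ(u, v) = (u v u⁻¹, u)` is `Ad_w`). [folklore] -/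
def HurwitzEquiv (w : F₂) (p q : F₂ × F₂) : Prop :=
  ∃ n : ℤ, q.1 = w ^ n * p.1 * (w ^ n)⁻¹ ∧ q.2 = w ^ n * p.2 * (w ^ n)⁻¹

/-- THE MOVES of the shadow walk on lists of group elements: the signed Hurwitz move
`(a, b) ↦ (a b a⁻¹, a)` and its inverse `(a, b) ↦ (b, b⁻¹ a b)` at any linear position (both
preserve the product of the list). (Gompf–Stipsicz §8.2.) [folklore] -/
inductive Move : List F₂ → List F₂ → Prop
  | hurwitz (pre post : List F₂) (a b : F₂) :
      Move (pre ++ a :: b :: post) (pre ++ (a * b * a⁻¹) :: a :: post)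
  | hurwitzInv (pre post : List F₂) (a b : F₂) :
      Move (pre ++ a :: b :: post) (pre ++ b :: (b⁻¹ * a * b) :: post)

/-- The orbit relation of the shadow walk: the equivalence relation generated by the moves.
[folklore] -/
def Reachable : List F₂ → List F₂ → Prop :=
  Relation.ReflTransGen fun s t => Move s t ∨ Move t s

/-- The start state `[a₁, a₂, b₂⁻¹, b₁⁻¹]`: the shadow of the block form `A · B̄ʳᵉᵛ` of the planar
bisection `X_A ∪ X̄_B`, `A = (d, a₁, a₂)`, `B = (d, b₁, b₂)`, central letters dropped. [folklore] -/
def startState (P Q : F₂ × F₂) : List F₂ :=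
  [P.1, P.2, Q.2⁻¹, Q.1⁻¹]

/-- BALL TARGET: two adjacent letters form the chain `(c x c⁻¹, c y c⁻¹)` — the positive block
`(d, c(c_[0,1]), c(c_[1,2]))` has trivial seam group (`∂X ≅ S³`, `X ≅ B⁴`). [folklore] -/
def IsBallState (s : List F₂) : Prop :=
  ∃ (c : F₂) (pre post : List F₂), s = pre ++ (c * gx * c⁻¹) :: (c * gy * c⁻¹) :: post

/-- DOUBLE TARGET: the state reads `[g₁, g₂, g₂⁻¹, g₁⁻¹]` with `g₁`, `g₂` positive — an honest
double `X_{(d, g₁, g₂)} ∪ X̄_{(d, g₁, g₂)}`. [folklore] -/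
def IsDoubleState (s : List F₂) : Prop :=
  ∃ g₁ g₂ : F₂, IsPos g₁ ∧ IsPos g₂ ∧ s = [g₁, g₂, g₂⁻¹, g₁⁻¹]

/-! ## The syntactic shadow of planar words on three holes -/

/-- Shadow of a generator: `T_[0,1]^{±1} ↦ x^{±1}`, `T_[1,2]^{±1} ↦ y^{±1}` (`inv = true` is the
negative twist, as in `PlanarWords.PGen.data`), every other generator (boundary twists, half-twists,
out-of-range round twists) `↦ 1`. [folklore] -/
def shadowGen : PGen → F₂
  | PGen.round 0 1 inv => if inv then gx⁻¹ else gx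
  | PGen.round 1 2 inv => if inv then gy⁻¹ else gy
  | _ => 1

/-- Shadow of a word of generators (product, first letter leftmost — the order of
`PlanarWords.evalWord`). [folklore] -/
def shadowWord (g : List PGen) : F₂ :=
  (g.map shadowGen).prod

/-- Shadow of a curve `g(c_[a,b])`: `ḡ · s · ḡ⁻¹` with `s` the shadow of the positive round twist
`T_[a,b]`. [folklore] -/
def shadowCurve (c : PlanarCurve) : F₂ :=
  shadowWord c.g * shadowGen (PGen.round c.a c.b false) * (shadowWord c.g)⁻¹

/-- Shadow of a signed letter: the shadow of `T_c^{±1}`. [folklore] -/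
def shadowLetter (l : Letter) : F₂ :=
  if l.2 then shadowCurve l.1 else (shadowCurve l.1)⁻¹

/-- A generator of the ROUND SUB-ALPHABET `{T_[0,1]^{±1}, T_[1,2]^{±1}}` (words in it are the pure
braids of `⟨A₁₂, A₂₃⟩ ≅ F₂`). [folklore] -/
def IsXYGen (p : PGen) : Prop :=
  ∃ inv : Bool, p = PGen.round 0 1 inv ∨ p = PGen.round 1 2 inv

/-- A CENTRAL letter in syntactic normal form: a boundary twist `T_[i,i]` (`i ≤ 2`) or the outer
boundary twist `T_[0,2]`, with empty carrying word. [folklore] -/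
def IsCentralCurve (d : PlanarCurve) : Prop :=
  d.g = [] ∧ ((d.a = d.b ∧ d.b ≤ 2) ∨ (d.a = 0 ∧ d.b = 2))

/-- SHADOW NORMAL FORM of an integral homotopy-sphere word on three holes (the `k = 4` reading of a
planar ℚ-acyclic Stein bisection of a homotopy 4-sphere, up to Hurwitz equivalence of each block
and one global conjugation): `A = [d, g₁(c_[0,1]), h₁(c_[1,2])]`, `B = [d, g₂(c_[0,1]), h₂(c_[1,2])]`
with ONE common central letter `d`, all carrying words in the round sub-alphabet, and equal
`F₂`-monodromies `x^{ḡ₁} y^{h̄₁} = x^{ḡ₂} y^{h̄₂}`. [folklore] -/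
def InShadowNormalForm (A B : List PlanarCurve) : Prop :=
  ∃ (d : PlanarCurve) (g₁ h₁ g₂ h₂ : List PGen),
    IsCentralCurve d ∧ (∀ p ∈ g₁ ++ h₁ ++ g₂ ++ h₂, IsXYGen p) ∧
    A = [d, ⟨0, 1, g₁⟩, ⟨1, 2, h₁⟩] ∧ B = [d, ⟨0, 1, g₂⟩, ⟨1, 2, h₂⟩] ∧
    shadowCurve ⟨0, 1, g₁⟩ * shadowCurve ⟨1, 2, h₁⟩ =
      shadowCurve ⟨0, 1, g₂⟩ * shadowCurve ⟨1, 2, h₂⟩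

/-! ## Definitional sanity lemmas -/

/-- Every state is reachable from itself. [folklore] -/
theorem Reachable.refl (s : List F₂) : Reachable s s :=
  Relation.ReflTransGen.refl

/-- A single move is a reachability step. [folklore] -/
theorem Move.reachable {s t : List F₂} (h : Move s t) : Reachable s t :=
  Relation.ReflTransGen.single (Or.inl h)

/-- Reachability is symmetric (the generating relation is). [folklore] -/
theorem Reachable.symm {s t : List F₂} (h : Reachable s t) : Reachable t s := by
  unfold Reachable at h ⊢
  induction h with
  | refl => exact Relation.ReflTransGen.refl
  | tail _ hbc ih => exact Relation.ReflTransGen.head hbc.symm ih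

/-- Reachability is transitive. [folklore] -/
theorem Reachable.trans {s t u : List F₂} (h₁ : Reachable s t) (h₂ : Reachable t u) :
    Reachable s u :=
  Relation.ReflTransGen.trans h₁ h₂

/-- The shadow of the empty word is `1`. [folklore] -/
theorem shadowWord_nil : shadowWord [] = 1 := rfl

/-- The shadow of a concatenation is the product of the shadows. [folklore] -/
theorem shadowWord_append (g h : List PGen) : shadowWord (g ++ h) = shadowWord g * shadowWord h := by
  simp [shadowWord, List.map_append, List.prod_append]

/-- The start state has four letters. [folklore] -/
theorem startState_length (P Q : F₂ × F₂) : (startState P Q).length = 4 := rfl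

/-- The start state of a pair with itself is an honest double as soon as both letters are positive
(zero moves). [folklore] -/
theorem isDoubleState_startState_self {P : F₂ × F₂} (h₁ : IsPos P.1) (h₂ : IsPos P.2) :
    IsDoubleState (startState P P) :=
  ⟨P.1, P.2, h₁, h₂, rfl⟩

end Literature.Topology.FourManifolds.PlanarShadow

end
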